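import Mathlib
import Summits.ValiantsHypothesis.ValiantsHypothesis.Theorems.BarrierLeverPartitionMinorsHitByVPProductStatesGeneral
import Summits.ValiantsHypothesis.ValiantsHypothesis.Theorems.BarrierLeverPartitionMinorsHitByVPNearPrincipalLayouts

/-!
# Route BarrierLever — item `PartitionMinorsHitByVP` (stmt-ValiantsHypothesis-19717):
# a RANK BOUND for sums of product states on block-column layouts (typed residue member)

Helper file (`--supports stmt-ValiantsHypothesis-19717`; cell valiant-natproofs, rung V4, 𝒟-side,
prover seat val-np-p6 gen 3). Definition-free. Closes NO item.

The cell / strata doors glue certified cells into ONE witness which — when every leaf is a product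
state (`∏_a q_a(x_a, y_{π a})`, arbitrary pairing `π` and site tables, file `…ProductStatesGeneral`),
an automorphic leaf (a product state), a transvection leaf (three product states) or a small sparse
leaf — is a SUM OF PRODUCT STATES plus a SPARSE polynomial (torus rescalings of a product state are
product states). This file bounds the rank of the Nisan partition matrix of any such witness on a
layout whose column sets all lie in a block `B`:

* `rank_layoutMatrix_prodStateC_le` — for ONE product state the layout matrix on `(u, w)` with
  `w j ⊆ B` factors through the TRACES `u i ∩ π⁻¹(B)`: its rank is at most the number of distinct
  traces (entry `= α(i) · ∏_{a ∈ π⁻¹ B} m a [a ∈ u i ∩ π⁻¹B] [π a ∈ w j]`).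
* `card_traces_le` — if every row set has `≤ m` elements, the number of traces on a `k`-set is
  `≤ Σ_{l ≤ m} C(k, l)`.
* `rank_add_le`, `rank_sum_le`, `layoutMatrix_add`, `layoutMatrix_sum`, `rank_layoutMatrix_monomial_le` —
  subadditivity of the rank; the layout matrix is additive in the witness; a monomial has rank `≤ 1`.
* **`layoutMatrix_det_eq_zero_of_prodStates`** — THE BOUND: if all `w j ⊆ B` (`|B| = k`), all
  `|u i| ≤ m`, and `f = Σ_{t<p} (product state)_t + Σ_{l<R} c_l · x^{S_l} y^{T_l}`, then the layout
  matrix of `f` on `(u, w)` is SINGULAR as soon as `p · Σ_{l≤m} C(k,l) + R < r` (`r` = number of rows).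

So the layouts "rows: `2^k` sets of weight `≤ m`; columns: all subsets of a `k`-block" (with
`C(k, ≤m) · poly(h) < 2^k`, e.g. `m = k/10`, or the chunk families of `…OrProjections` with
`m = ⌈k/s⌉`) defeat every poly-size sum of product states + sparse — in particular every poly-leaf
cell certificate with such leaves — while `…OrProjections.partitionMinor_hit_of_orProjection` HITS the
chunk families among them: the first explicit super-polynomial class outside the product-state
calculus and inside an unconditional theorem.

WHAT THIS IS NOT: no statement about Kronecker products of sparse leaves (block-product door) or about
general circuits; nothing on crux 14610 or VP vs VNP.
-/

set_option linter.dupNamespace false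

namespace Summit.ValiantsHypothesis.ValiantsHypothesis.Theorems.BarrierLever.ProductStateRank

open Finset MvPolynomial
open Summit.ValiantsHypothesis.ValiantsHypothesis.Theorems.BarrierLever.ProductStateSums
  (castAdd_ne_natAdd partitionExpo_apply_castAdd partitionExpo_apply_natAdd partitionExpo_inj)
open Summit.ValiantsHypothesis.ValiantsHypothesis.Theorems.BarrierLever.ProductStatesC
  (coeff_prodStateC)

noncomputable section

variable {h : ℕ}

/-! ## 1. Rank bookkeeping -/

/-- Subadditivity of the rank of complex matrices. -/
theorem rank_add_le {ι κ : Type*} [Fintype ι] [Fintype κ] [DecidableEq κ] (A B : Matrix ι κ ℂ) :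
    (A + B).rank ≤ A.rank + B.rank := by
  unfold Matrix.rank
  rw [Matrix.mulVecLin_add]
  calc Module.finrank ℂ (LinearMap.range (A.mulVecLin + B.mulVecLin))
      ≤ Module.finrank ℂ ↥(LinearMap.range A.mulVecLin ⊔ LinearMap.range B.mulVecLin) :=
        Submodule.finrank_mono (LinearMap.range_add_le _ _)
    _ ≤ _ := Submodule.finrank_add_le_finrank_add_finrank _ _

/-- Subadditivity over a `Finset` sum. -/
theorem rank_sum_le {ι κ α : Type*} [Fintype ι] [Fintype κ] [DecidableEq κ] [DecidableEq α]
    (s : Finset α) (A : α → Matrix ι κ ℂ) :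
    (∑ t ∈ s, A t).rank ≤ ∑ t ∈ s, (A t).rank := by
  induction s using Finset.induction_on with
  | empty => simp [Matrix.rank_zero]
  | insert a s ha ih =>
    rw [Finset.sum_insert ha, Finset.sum_insert ha]
    exact (rank_add_le _ _).trans (by gcongr)

/-- A square complex matrix of rank `< r` is singular. -/
theorem det_eq_zero_of_rank_lt {ι : Type*} [Fintype ι] [DecidableEq ι] (M : Matrix ι ι ℂ)
    (hr : M.rank < Fintype.card ι) : M.det = 0 := by
  by_contra hdet
  have hU : IsUnit M := (Matrix.isUnit_iff_isUnit_det M).mpr (isUnit_iff_ne_zero.mpr hdet)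
  have := Matrix.rank_of_isUnit M hU
  omega

/-! ## 2. One product state: the layout matrix factors through the traces -/

/-- The layout matrix of a general product state on `(u, w)`, all columns inside `B`: entry `(i, j)` is
`(∏_{a ∉ C} m a [a ∈ u i] ff) · ∏_{a ∈ C} m a [a ∈ u i ∩ C] [π a ∈ w j]` with `C = π⁻¹ B`. -/
theorem layoutMatrix_prodStateC_apply {ι : Type*} (u w : ι → Finset (Fin h)) (B : Finset (Fin h))
    (hB : ∀ j, w j ⊆ B) (m : Fin h → Bool → Bool → ℂ) (π : Equiv.Perm (Fin h)) (i j : ι) :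
    MvPolynomial.coeff (∑ a ∈ u i, Finsupp.single (Fin.castAdd h a) 1 +
        ∑ c ∈ w j, Finsupp.single (Fin.natAdd h c) 1)
      (∏ a, ∑ p : Bool × Bool, C (m a p.1 p.2) * X (Fin.castAdd h a) ^ p.1.toNat *
        X (Fin.natAdd h (π a)) ^ p.2.toNat : MvPolynomial (Fin (h + h)) ℂ) =
      (∏ a ∈ Finset.univ.filter (fun a => π a ∉ B), m a (decide (a ∈ u i)) false) *
        ∏ a ∈ Finset.univ.filter (fun a => π a ∈ B),
          m a (decide (a ∈ u i ∩ Finset.univ.filter (fun a => π a ∈ B))) (decide (π a ∈ w j)) := by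
  rw [coeff_prodStateC, ← Finset.prod_filter_mul_prod_filter_not Finset.univ (fun a => π a ∈ B),
    mul_comm]
  congr 1
  · refine Finset.prod_congr rfl fun a ha => ?_
    rw [Finset.mem_filter] at ha
    have : decide (π a ∈ w j) = false := decide_eq_false fun hmem => ha.2 (hB j hmem)
    rw [this]
  · refine Finset.prod_congr rfl fun a ha => ?_
    rw [show decide (a ∈ u i ∩ Finset.univ.filter (fun a => π a ∈ B)) = decide (a ∈ u i) from
      decide_eq_decide.mpr ⟨fun hmem => (Finset.mem_inter.mp hmem).1,
        fun hmem => Finset.mem_inter.mpr ⟨hmem, ha⟩⟩]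

/-- **Rank of one product state on a block-column layout ≤ number of traces.** -/
theorem rank_layoutMatrix_prodStateC_le {ι : Type*} [Fintype ι] [DecidableEq ι]
    (u w : ι → Finset (Fin h)) (B : Finset (Fin h)) (hB : ∀ j, w j ⊆ B)
    (m : Fin h → Bool → Bool → ℂ) (π : Equiv.Perm (Fin h)) :
    (Matrix.of fun i j : ι => MvPolynomial.coeff (∑ a ∈ u i, Finsupp.single (Fin.castAdd h a) 1 +
        ∑ c ∈ w j, Finsupp.single (Fin.natAdd h c) 1)
      (∏ a, ∑ p : Bool × Bool, C (m a p.1 p.2) * X (Fin.castAdd h a) ^ p.1.toNat *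
        X (Fin.natAdd h (π a)) ^ p.2.toNat : MvPolynomial (Fin (h + h)) ℂ)).rank ≤
      (Finset.univ.image (fun i => u i ∩ Finset.univ.filter (fun a => π a ∈ B))).card := by
  classical
  -- factor `M = P * Q` through the subtype of traces
  have hmem : ∀ i, u i ∩ Finset.univ.filter (fun a => π a ∈ B) ∈
      Finset.univ.image (fun i => u i ∩ Finset.univ.filter (fun a => π a ∈ B)) :=
    fun i => Finset.mem_image_of_mem _ (Finset.mem_univ i)
  have hfac : (Matrix.of fun i j : ι => MvPolynomial.coeff (∑ a ∈ u i,
      Finsupp.single (Fin.castAdd h a) 1 + ∑ c ∈ w j, Finsupp.single (Fin.natAdd h c) 1)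
      (∏ a, ∑ p : Bool × Bool, C (m a p.1 p.2) * X (Fin.castAdd h a) ^ p.1.toNat *
        X (Fin.natAdd h (π a)) ^ p.2.toNat : MvPolynomial (Fin (h + h)) ℂ)) =
      (Matrix.of fun (i : ι)
          (r : ↥(Finset.univ.image (fun i => u i ∩ Finset.univ.filter (fun a => π a ∈ B)))) =>
        if u i ∩ Finset.univ.filter (fun a => π a ∈ B) = r.1 then
          ∏ a ∈ Finset.univ.filter (fun a => π a ∉ B), m a (decide (a ∈ u i)) false else 0) *
      Matrix.of fun (r : ↥(Finset.univ.image (fun i => u i ∩ Finset.univ.filter (fun a => π a ∈ B))))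
          (j : ι) =>
        ∏ a ∈ Finset.univ.filter (fun a => π a ∈ B), m a (decide (a ∈ r.1)) (decide (π a ∈ w j)) := by
    ext i j
    rw [Matrix.of_apply, layoutMatrix_prodStateC_apply u w B hB m π i j, Matrix.mul_apply,
      Finset.sum_eq_single ⟨_, hmem i⟩]
    · rw [Matrix.of_apply, Matrix.of_apply, if_pos rfl]
    · intro r _ hr
      rw [Matrix.of_apply, if_neg (fun heq => hr (Subtype.ext heq.symm)), zero_mul]
    · intro habs; exact absurd (Finset.mem_univ _) habs
  rw [hfac]
  refine (Matrix.rank_mul_le_left _ _).trans ((Matrix.rank_le_card_width _).trans ?_)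
  rw [Fintype.card_coe]

/-- **Counting traces.** If every row set has at most `m` elements, the traces on a set `C₀` of size
`k` number at most `Σ_{l ≤ m} C(k, l)`. -/
theorem card_traces_le {ι : Type*} [Fintype ι] (u : ι → Finset (Fin h)) (C₀ : Finset (Fin h))
    (m : ℕ) (hu : ∀ i, (u i).card ≤ m) :
    (Finset.univ.image (fun i => u i ∩ C₀)).card ≤
      ∑ l ∈ Finset.range (m + 1), (C₀.card).choose l := by
  classical
  calc (Finset.univ.image (fun i => u i ∩ C₀)).card
      ≤ ((Finset.range (m + 1)).biUnion (fun l => C₀.powersetCard l)).card := by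
        refine Finset.card_le_card fun R hR => ?_
        rw [Finset.mem_image] at hR
        obtain ⟨i, _, rfl⟩ := hR
        rw [Finset.mem_biUnion]
        refine ⟨(u i ∩ C₀).card, Finset.mem_range.mpr (Nat.lt_succ_of_le
          ((Finset.card_le_card Finset.inter_subset_left).trans (hu i))), ?_⟩
        rw [Finset.mem_powersetCard]
        exact ⟨Finset.inter_subset_right, rfl⟩
    _ ≤ ∑ l ∈ Finset.range (m + 1), (C₀.powersetCard l).card := Finset.card_biUnion_le
    _ = ∑ l ∈ Finset.range (m + 1), (C₀.card).choose l := by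
        refine Finset.sum_congr rfl fun l _ => ?_
        rw [Finset.card_powersetCard]

/-- The preimage block `π⁻¹ B` has the size of `B`. -/
theorem card_filter_perm_mem (B : Finset (Fin h)) (π : Equiv.Perm (Fin h)) :
    (Finset.univ.filter (fun a : Fin h => π a ∈ B)).card = B.card := by
  have : Finset.univ.filter (fun a : Fin h => π a ∈ B) = B.map π.symm.toEmbedding := by
    ext a
    rw [Finset.mem_filter, Finset.mem_map_equiv]
    simp
  rw [this, Finset.card_map]

/-! ## 3. Sparse terms -/

/-- The layout matrix of one monomial `c · x^S y^T` has rank `≤ 1`. -/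
theorem rank_layoutMatrix_monomial_le {ι : Type*} [Fintype ι] [DecidableEq ι]
    (u w : ι → Finset (Fin h)) (c : ℂ) (S T : Finset (Fin h)) :
    (Matrix.of fun i j : ι => MvPolynomial.coeff (∑ a ∈ u i, Finsupp.single (Fin.castAdd h a) 1 +
        ∑ c ∈ w j, Finsupp.single (Fin.natAdd h c) 1)
      (monomial (∑ a ∈ S, Finsupp.single (Fin.castAdd h a) 1 +
        ∑ c ∈ T, Finsupp.single (Fin.natAdd h c) 1) c : MvPolynomial (Fin (h + h)) ℂ)).rank ≤ 1 := by
  classical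
  have hmat : (Matrix.of fun i j : ι => MvPolynomial.coeff (∑ a ∈ u i,
      Finsupp.single (Fin.castAdd h a) 1 + ∑ c ∈ w j, Finsupp.single (Fin.natAdd h c) 1)
      (monomial (∑ a ∈ S, Finsupp.single (Fin.castAdd h a) 1 +
        ∑ c ∈ T, Finsupp.single (Fin.natAdd h c) 1) c : MvPolynomial (Fin (h + h)) ℂ)) =
      Matrix.vecMulVec (fun i => if u i = S then c else 0) (fun j => if w j = T then 1 else 0) := by
    ext i j
    rw [Matrix.of_apply, Matrix.vecMulVec_apply, coeff_monomial]
    by_cases hij : u i = S ∧ w j = T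
    · rw [if_pos (by rw [hij.1, hij.2]), if_pos hij.1, if_pos hij.2, mul_one]
    · rw [if_neg]
      · by_cases hi : u i = S
        · rw [if_pos hi, if_neg (fun hj => hij ⟨hi, hj⟩), mul_zero]
        · rw [if_neg hi, zero_mul]
      · intro heq
        exact hij ((partitionExpo_inj S T (u i) (w j) heq).imp Eq.symm Eq.symm)
  rw [hmat]
  exact Matrix.rank_vecMulVec_le _ _

/-! ## 4. The bound -/

/-- The layout matrix is additive in the witness. -/
theorem layoutMatrix_add {ι : Type*} (u w : ι → Finset (Fin h)) (f g : MvPolynomial (Fin (h + h)) ℂ) :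
    (Matrix.of fun i j : ι => MvPolynomial.coeff (∑ a ∈ u i, Finsupp.single (Fin.castAdd h a) 1 +
        ∑ c ∈ w j, Finsupp.single (Fin.natAdd h c) 1) (f + g)) =
      (Matrix.of fun i j : ι => MvPolynomial.coeff (∑ a ∈ u i, Finsupp.single (Fin.castAdd h a) 1 +
        ∑ c ∈ w j, Finsupp.single (Fin.natAdd h c) 1) f) +
      Matrix.of fun i j : ι => MvPolynomial.coeff (∑ a ∈ u i, Finsupp.single (Fin.castAdd h a) 1 +
        ∑ c ∈ w j, Finsupp.single (Fin.natAdd h c) 1) g := by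
  ext i j
  simp only [Matrix.of_apply, Matrix.add_apply, coeff_add]

/-- The layout matrix is additive over `Finset` sums of witnesses. -/
theorem layoutMatrix_sum {ι α : Type*} [DecidableEq α] (u w : ι → Finset (Fin h)) (s : Finset α)
    (f : α → MvPolynomial (Fin (h + h)) ℂ) :
    (Matrix.of fun i j : ι => MvPolynomial.coeff (∑ a ∈ u i, Finsupp.single (Fin.castAdd h a) 1 +
        ∑ c ∈ w j, Finsupp.single (Fin.natAdd h c) 1) (∑ t ∈ s, f t)) =
      ∑ t ∈ s, Matrix.of fun i j : ι => MvPolynomial.coeff (∑ a ∈ u i,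
        Finsupp.single (Fin.castAdd h a) 1 + ∑ c ∈ w j, Finsupp.single (Fin.natAdd h c) 1) (f t) := by
  induction s using Finset.induction_on with
  | empty =>
    ext i j
    simp
  | insert a s ha ih =>
    rw [Finset.sum_insert ha, Finset.sum_insert ha, layoutMatrix_add, ih]

/-- **THE RANK BOUND / typed residue member.** Columns inside a block `B` of size `k`, rows of weight
`≤ m`, witness = `p` general product states (pairings `π t`, site tables `mt t`) plus `R` scaled
monomials `c l · x^{S l} y^{T l}`: if `p · Σ_{l≤m} C(k,l) + R < r` the layout matrix is singular. -/
theorem layoutMatrix_det_eq_zero_of_prodStates {ι : Type*} [Fintype ι] [DecidableEq ι]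
    (u w : ι → Finset (Fin h)) (B : Finset (Fin h)) (hB : ∀ j, w j ⊆ B) (m : ℕ)
    (hu : ∀ i, (u i).card ≤ m) {p R : ℕ} (π : Fin p → Equiv.Perm (Fin h))
    (mt : Fin p → Fin h → Bool → Bool → ℂ) (c : Fin R → ℂ) (S T : Fin R → Finset (Fin h))
    (hsmall : p * (∑ l ∈ Finset.range (m + 1), (B.card).choose l) + R < Fintype.card ι) :
    (Matrix.of fun i j : ι => MvPolynomial.coeff (∑ a ∈ u i, Finsupp.single (Fin.castAdd h a) 1 +
        ∑ c ∈ w j, Finsupp.single (Fin.natAdd h c) 1)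
      ((∑ t : Fin p, ∏ a, ∑ q : Bool × Bool, C (mt t a q.1 q.2) * X (Fin.castAdd h a) ^ q.1.toNat *
          X (Fin.natAdd h (π t a)) ^ q.2.toNat) +
        ∑ l : Fin R, monomial (∑ a ∈ S l, Finsupp.single (Fin.castAdd h a) 1 +
          ∑ c ∈ T l, Finsupp.single (Fin.natAdd h c) 1) (c l) : MvPolynomial (Fin (h + h)) ℂ)).det
      = 0 := by
  classical
  refine det_eq_zero_of_rank_lt _ (lt_of_le_of_lt ?_ hsmall)
  rw [layoutMatrix_add, layoutMatrix_sum, layoutMatrix_sum]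
  refine (rank_add_le _ _).trans (add_le_add ?_ ?_)
  · refine (rank_sum_le _ _).trans ?_
    calc ∑ t : Fin p, (Matrix.of fun i j : ι => MvPolynomial.coeff (∑ a ∈ u i,
          Finsupp.single (Fin.castAdd h a) 1 + ∑ c ∈ w j, Finsupp.single (Fin.natAdd h c) 1)
          (∏ a, ∑ q : Bool × Bool, C (mt t a q.1 q.2) * X (Fin.castAdd h a) ^ q.1.toNat *
            X (Fin.natAdd h (π t a)) ^ q.2.toNat : MvPolynomial (Fin (h + h)) ℂ)).rank
        ≤ ∑ _t : Fin p, ∑ l ∈ Finset.range (m + 1), (B.card).choose l := by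
          refine Finset.sum_le_sum fun t _ => ?_
          refine (rank_layoutMatrix_prodStateC_le u w B hB (mt t) (π t)).trans ?_
          rw [← card_filter_perm_mem B (π t)]
          exact card_traces_le u _ m hu
      _ = p * ∑ l ∈ Finset.range (m + 1), (B.card).choose l := by simp
  · calc (∑ l : Fin R, Matrix.of fun i j : ι => MvPolynomial.coeff (∑ a ∈ u i,
          Finsupp.single (Fin.castAdd h a) 1 + ∑ c ∈ w j, Finsupp.single (Fin.natAdd h c) 1)
          (monomial (∑ a ∈ S l, Finsupp.single (Fin.castAdd h a) 1 +
            ∑ c ∈ T l, Finsupp.single (Fin.natAdd h c) 1) (c l) : MvPolynomial (Fin (h + h)) ℂ)).rank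
        ≤ ∑ _l : Fin R, 1 := (rank_sum_le _ _).trans
          (Finset.sum_le_sum fun l _ => rank_layoutMatrix_monomial_le u w (c l) (S l) (T l))
      _ = R := by simp

end

end Summit.ValiantsHypothesis.ValiantsHypothesis.Theorems.BarrierLever.ProductStateRank
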